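/-
Copyright (c) 2026 the pub-hodgecm-mathlib formalisation cell (harness21).  Prover seat hodgecm-mathlib-LH4-p07 (g0): unit U2H_HSide of the «(D-RAM) FOUR-FRAME» road,
TIER-2 file (№2 of 2) paying the stub `stub_U2H_stableOI_hProfiles_typeOne_wild` of `Cruxes/H413/Lines/F0_P3c_DyRamFourFrame_U2H_HSide.lean` (ED. 3, §1b) BY NAME (heir
LEAD F0P3a-plan (g19) «FOUR-FRAME SKELETON LANDED» EMIT LIST #4; dealer LH4-plan (g10)).  2026-09-03.
-/
import Summits.HodgeConjecture.HodgeConjecture.Theorems.F0P3cDyRamHProfilesFrameDepth       -- helper №1 (this seat): frame algebra, re-eigenvaluing, the two profiles read (frame, depth)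
import Summits.HodgeConjecture.HodgeConjecture.Theorems.F0P3cDyRamHFamilySmooth             -- ★ p854867 LH4-p05 (g0): `isLocSmooth_hFamily` (stub #2)
import Literature.NumberTheory.Rogawski1990.RankOneStableOrbitalIntegralTorus                 -- ★ T6-1u′ ADAPTER `stableOrbitalIntegralRel_eq_integral_add_integral_of_frame` (place-generic: no `|2| = 1`)
import Literature.NumberTheory.Rogawski1990.LocalStableClassesHTwo                            -- ★ `exists_isLocalStablyConjH_not_isConj_forall_isConj_or` (the partner class), `IsLocalStablyConjH.snd_eq`
import Literature.NumberTheory.Automorphic.StableCentralizerEquivCM                            -- ★ `localStableCentralizerEquiv`, `coe_localStableCentralizerEquiv_eq_of_conj_eq`, `commute_of_commute_of_isRegularElt_local`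
import Literature.NumberTheory.Automorphic.RankTwoEigenframeOfSplitCharpoly                    -- ★ `exists_eigenframe_cmDatum_local_of_isRoot_map_of_separable`
import Literature.NumberTheory.Rogawski1990.LocalHyperbolicClassIsLevi                        -- ★ `forall_conjLocal_mul_eq_one_of_not_exists_conj_glDiagonal` (ellipticity ⇒ norm-one eigen-data)
import Literature.NumberTheory.Rogawski1990.UnitStableOrbitalIntegralHSideValueStubFrame      -- ★ `eq_or_eq_eval_of_isRoot_of_eigenframe`
import Literature.NumberTheory.Rogawski1990.LocalCentralizerTorusMeasureCM                    -- ★ `isRegularElt_fst_snd_of_isLocalGRegular`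
import Literature.NumberTheory.Rogawski1990.UnitFundamentalLemmaInertLeviClause               -- ★ `isLocalGRegular_conj_iff`
import Literature.NumberTheory.Rogawski1990.LocalTransferCompactSideJunctionCM                -- ★ `isLocalGRegular_of_isLocalStablyConjH`
import Literature.NumberTheory.Automorphic.LocalUnitaryIntegralLevel                           -- ★ `isCompact_isOpen_cmLocalIntegralLevel` (positivity of `ν_H(K_H)`)
import HarnessLib

/-!
# Crux `H413`, line LH4 «(D-RAM) FOUR-FRAME» — unit U2H_HSide (ii-H), TIER 2: the STABLE orbital integrals of the two H-side vertex profiles at an elliptic type-(1) `γ_H`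
# depend on the depth `N = ord_w(α − γ)` ONLY, at ANY ramified non-split CM place — wild included (pays `F0P3cDyRamFourFrameU2H.stub_U2H_stableOI_hProfiles_typeOne_wild` BY NAME)

Cell `hodgecm-mathlib` (D-0151), FLOOR 0, crux item H413 = `stmt-HodgeConjecture-24833`, route of record `HCCMUnconditional`; squad F0∕P3c∕LH4; tier-1 module
`Cruxes/H413/Lines/F0_P3c_DyRamFourFrame_U2H_HSide.lean` ED. 3 (assembler LH4-p03 (g11), dealer LH4-plan (g10)), §1b stub `stub_U2H_stableOI_hProfiles_typeOne_wild` (desk row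
`stableOI_H_edgeBall`, «the WILD H-side census dictionary», size M–L).  THEOREMS ONLY (no `def`, no instance, no notation, no named fact, no `sorry`; two `L_v`-sized statements carry an elaboration budget `maxHeartbeats 800000`, as the ★ adapter); lane
`--supports stmt-HodgeConjecture-24833` (count-neutral).

WHAT IS PROVED.  §2 `stableOrbitalIntegralRel_hFamily_eq_mul_of_depth` — the statement of the stub TOKEN FOR TOKEN (binders `hw`, `he`, `_h2`, `ϖ`, `hϖ`, the measurability
instances, `νH`, `hmH`): at a ramified non-split CM place `w ∣ v`, for the canonical family `mH`, there are depth profiles `Y : Fin 2 → ℕ → ℂ` and a neighbourhood `V` of `1`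
such that for every `G`-regular ELLIPTIC type-(1) `γ_H ∈ V` with split eigen-data `α ≠ γ` at `w` of depth `N = ord_w(α − γ)`, `Φ^st(γ_H, hFamily s) = ν_H(K_H) · Y s N` for both
profiles `s = 0` (`1_{K_H}`) and `s = 1` (`1_{K♯ × U₁}`) of DEFS LEAF №5.  The dyadic binder `_h2 : 2 ∉ 𝒪_w^×` is NOT used: the theorem holds at every ramified non-split place
(the tame twin ★ `stableOrbitalIntegralRel_typeOne_HSideProfiles_ramified`, F0P2-p06 (g12), gives moreover the closed form of `Y`; here only the DEPTH-ONLY dependence is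
claimed, which is what the stub states, and it is proved STRUCTURALLY — no tree count, no `|2|_w = 1`, no anti-fixed uniformiser).  `V = H_v` (all of it) is a legitimate witness.

THE MATHEMATICS (why `Φ^st(γ_H, 1_K)` is a function of the depth alone; [Rogawski1990] §3.6, §4.1 (4.1.1), Lemma 4.9.3; [LabesseLanglands1979] §2).  Let `K ⊂ GL₂(L_w)` be a
lattice stabiliser (`GL₂(𝒪_w)` for `K_H`, `D_ϖ GL₂(𝒪_w) D_ϖ⁻¹` for `K♯`) and `f = 1_{(U ∩ K) × U₁}`.
(1) FRAME∕DEPTH LEMMA (helper №1 ★ `F0P3cDyRamHProfilesFrameDepth`).  If `g ∈ U(Φ₂)_v` has the eigenframe `g Q = Q diag(d₀, d₁)` with `|dᵢ|_w = 1`, then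
  `g = d₁·1 + (d₀ − d₁)·Q e₁₁ Q⁻¹`, so every entry test `|c_{ab} g_{ab}|_w ≤ 1` with `c_{aa} = 1` depends on `d` only through `|d₀ − d₁|_w = q^{−N}`.  Hence `f(g, ·)`
  depends only on `(Q, N)` for `f = 1_{K_H}, 1_{K♯ × U₁}` (`hProfileZero_eq_of_frame`, `hProfileSharp_eq_of_frame`), and so does `f(y g y⁻¹)` for every `y ∈ H_v` (frame `y Q`).
(2) STABLE INVARIANCE (§1 `stableOrbitalIntegralRel_eq_of_frames_of_depth_eq`).  Given two qualifying elements `γ_H` (frame `P`, eigenvalues `u`) and `γ_H′` (frame `P′`,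
  eigenvalues `u′`) of the same depth, RE-EIGENVALUE `γ_H′`: `ε := (P′ diag(u) P′⁻¹, γ_H.2)` is unitary (helper №1 `conj_glDiagonal_mem_unitaryGroupOfForm_of_eigenframe`: the Gram
  matrix of an eigenframe of a unitary element with distinct norm-one eigenvalues is diagonal, ★ `twistGram_eigenframe_eq_diagonal`), STABLY CONJUGATE to `γ_H` (conjugator
  `P′P⁻¹ ∈ GL₂(E_v)`, equal `U(Φ₁)`-parts), hence `Φ^st(γ_H, f) = Φ^st(ε, f)` (★ `stableOrbitalIntegralRel_congr`) and `ε` is `G`-regular (★ stable closure).  By the ★ ADAPTER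
  `Φ^st(t, f) = O_ν(t, f) + O_ν(t′, f)` for any `t′` stably conjugate and not conjugate to `t`: take for `γ_H′` the partner `δ′ = (x γ′₂ x⁻¹, γ′₁)` of ★
  `exists_isLocalStablyConjH_not_isConj_forall_isConj_or`, and for `ε` its transport `δ_ε = (x ε₂ x⁻¹, ε.2)` along the SAME `x` (★ `localStableCentralizerEquiv`; not conjugate
  to `ε`, because a conjugator `c` would give `x⁻¹c ∈ Z_{GL₂}(ε₂) = Z_{GL₂}(γ′₂)`, the commutant of a regular element being commutative ★, making `δ′` conjugate to `γ_H′`).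
  Now `ε, γ_H′` share the frame `P′` and `δ_ε, δ′` share the frame `x P′`, all of depth `N`, so by (1) the four Bochner integrands agree pairwise and
  `Φ^st(γ_H, f) = O(ε) + O(δ_ε) = O(γ_H′) + O(δ′) = Φ^st(γ_H′, f)`.
(3) §2: `Y s N := Φ^st(γ₀, hFamily s) ∕ ν_H(K_H)` for a chosen qualifying `γ₀` of depth `N` (else `0`), `V := univ`; the eigenframes come from the root `α` (★
  `exists_eigenframe_cmDatum_local_of_isRoot_map_of_separable`), norm-one eigen-data from ellipticity (★ `forall_conjLocal_mul_eq_one_of_not_exists_conj_glDiagonal`).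

HONEST LABEL.  Count-neutral; the verdict of record for (D-RAM) stays PRINT [LanglandsShelstad1989 Thm. p. 484 ∕ Rogawski1990 Prop. 4.9.1 (a)] ∕ XL; `HC_CM` is proved only
modulo the 7 printed citations (2 remaining: hLiu418 = `stmt-HodgeConjecture-24832`, h413 = `stmt-HodgeConjecture-24833`) until rung 0 closes.  The CLOSED FORM of `Y`
(«2 × B-level edge ball», memo v1.4 §5) is NOT claimed here (a later stub `stub_U2H_hProfileCount_closedForm`).

## References
* [Rogawski1990] J. D. Rogawski, *Automorphic Representations of Unitary Groups in Three Variables*, Ann. of Math. Stud. 123 (1990): §3.1 p. 19, §3.5 Prop. 3.5.2 p. 29, §3.6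
  p. 31 (type-(1) tori and their frames), §4.1 (4.1.1) p. 39 and §4.3 (4.3.1) p. 43 (stable orbital integrals), §4.9 Lemma 4.9.3 p. 56.
* [LabesseLanglands1979] J.-P. Labesse, R. P. Langlands, *L-indistinguishability for SL(2)*, Canad. J. Math. 31 (1979), §2 (the two classes in an elliptic stable class).
* [Serre1980Trees] J.-P. Serre, *Trees* (1980), Ch. II §1.1 (lattice stabilisers in `GL₂` by entries).
-/

noncomputable section

namespace Summit.HodgeConjecture.HodgeConjecture.Cruxes.H413.F0P3cDyRamU2HStableOIHProfilesTypeOneWild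

open MeasureTheory Measure NumberField IsDedekindDomain Topology Filter Matrix
open Literature.NumberTheory.Automorphic Literature.NumberTheory.Automorphic.UnitaryGroup Literature.NumberTheory.Automorphic.IntegralReduction
open Literature.NumberTheory.Rogawski1990 Literature.NumberTheory.GaloisRepresentations
open Summit.HodgeConjecture.HodgeConjecture.Cruxes.H413.F0P3cDyRamFourFrameHSideDefs
open Summit.HodgeConjecture.HodgeConjecture.Cruxes.H413.F0P3cDyRamFourFrameHFamilyDefs
open Summit.HodgeConjecture.HodgeConjecture.Cruxes.H413.F0P3cDyRamHProfilesFrameDepth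
open scoped Matrix MatrixGroups Classical ValuativeRel WithZero

section Place

variable (L : Type) [Field L] [NumberField L] [IsCMField L] {v : HeightOneSpectrum (𝓞 ↥(maximalRealSubfield L))}
  (w : PlacesOver L v) (hw : IsCMField.complexConj L • w.1 = w.1)

/-! ## §1  STABLE INVARIANCE: `Φ^st(·, f)` of a (frame, depth)-reading `f` agrees at any two elliptic type-(1) elements of the same depth -/

include hw in
-- `L_v`-sized statement and a long composition of ★ lemmas: elaboration budget only (no search)
set_option maxHeartbeats 800000 in
/-- **`Φ^st(γ_H, f) = Φ^st(γ_H′, f)` FOR TWO ELLIPTIC TYPE-(1) ELEMENTS OF THE SAME DEPTH**, for every `f ∈ C_c^∞(H_v)` that sees an element only through (frame, depth)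
(`hfI`, the shape of ★ helper №1 `hProfileZero_eq_of_frame` ∕ `hProfileSharp_eq_of_frame`) and every CANONICAL family `mH` for `(IsLocalGRegular, ν_H)`.  `γ_H` is `G`-regular with an eigenframe `(P, u)` of norm-one data; `γ_H′` is
`G`-regular with an eigenframe `(P′, u′)`, `u′` injective of norm one; `|u₀ − u₁|_w = |u′₀ − u′₁|_w`.  PROOF (module docstring (2)): re-eigenvalue `γ_H′` to
`ε = (P′ diag(u) P′⁻¹, γ_H.2)` (★ helper №1 `conj_glDiagonal_mem_unitaryGroupOfForm_of_eigenframe`, unitary), stably conjugate to `γ_H` (★ `stableOrbitalIntegralRel_congr`), transport the partner `δ′` of `γ_H′` (★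
`exists_isLocalStablyConjH_not_isConj_forall_isConj_or`) along the same stable conjugator to a partner `δ_ε` of `ε` (★ `localStableCentralizerEquiv`; non-conjugacy by ★
`commute_of_commute_of_isRegularElt_local`), read both stable orbital integrals by the ★ ADAPTER `stableOrbitalIntegralRel_eq_integral_add_integral_of_frame` and compare the
four Bochner integrands pointwise by `hfI` (frames `y P′`, `y x P′`). [cite: Rogawski1990, §4.1 (4.1.1) p. 39; §4.3 (4.3.1) p. 43; §3.6 p. 31; §4.9 Lemma 4.9.3 p. 56]
[cite: LabesseLanglands1979, §2] -/
theorem stableOrbitalIntegralRel_eq_of_frames_of_depth_eq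
    [MeasurableSpace ((cmDatum L 2 (Matrix.of fun i j : Fin 2 => if i.val + j.val + 1 = 2 then (1 : L) else 0)).Local v × (cmDatum L 1 (Matrix.of fun i j : Fin 1 => if i.val + j.val + 1 = 1 then (1 : L) else 0)).Local v)] [BorelSpace ((cmDatum L 2 (Matrix.of fun i j : Fin 2 => if i.val + j.val + 1 = 2 then (1 : L) else 0)).Local v × (cmDatum L 1 (Matrix.of fun i j : Fin 1 => if i.val + j.val + 1 = 1 then (1 : L) else 0)).Local v)]
    [∀ a : ((cmDatum L 2 (Matrix.of fun i j : Fin 2 => if i.val + j.val + 1 = 2 then (1 : L) else 0)).Local v × (cmDatum L 1 (Matrix.of fun i j : Fin 1 => if i.val + j.val + 1 = 1 then (1 : L) else 0)).Local v), MeasurableSpace (((cmDatum L 2 (Matrix.of fun i j : Fin 2 => if i.val + j.val + 1 = 2 then (1 : L) else 0)).Local v × (cmDatum L 1 (Matrix.of fun i j : Fin 1 => if i.val + j.val + 1 = 1 then (1 : L) else 0)).Local v) ⧸ Subgroup.centralizer ({a} : Set ((cmDatum L 2 (Matrix.of fun i j : Fin 2 => if i.val + j.val + 1 = 2 then (1 :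 L) else 0)).Local v × (cmDatum L 1 (Matrix.of fun i j : Fin 1 => if i.val + j.val + 1 = 1 then (1 : L) else 0)).Local v)))]
    [∀ a : ((cmDatum L 2 (Matrix.of fun i j : Fin 2 => if i.val + j.val + 1 = 2 then (1 : L) else 0)).Local v × (cmDatum L 1 (Matrix.of fun i j : Fin 1 => if i.val + j.val + 1 = 1 then (1 : L) else 0)).Local v), BorelSpace (((cmDatum L 2 (Matrix.of fun i j : Fin 2 => if i.val + j.val + 1 = 2 then (1 : L) else 0)).Local v × (cmDatum L 1 (Matrix.of fun i j : Fin 1 => if i.val + j.val + 1 = 1 then (1 : L) else 0)).Local v) ⧸ Subgroup.centralizer ({a} : Set ((cmDatum L 2 (Matrix.of fun i j : Fin 2 => if i.val + j.val + 1 = 2 then (1 : L) else 0)).Local v × (cmDatum L 1 (Matrix.of fun i j : Fin 1 => if i.val + j.val + 1 = 1 then (1 : L) else 0)).Local v)))]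
    (νH : Measure ((cmDatum L 2 (Matrix.of fun i j : Fin 2 => if i.val + j.val + 1 = 2 then (1 : L) else 0)).Local v × (cmDatum L 1 (Matrix.of fun i j : Fin 1 => if i.val + j.val + 1 = 1 then (1 : L) else 0)).Local v)) [νH.IsHaarMeasure] [νH.IsMulRightInvariant]
    {mH : OrbitalMeasureFamily ((cmDatum L 2 (Matrix.of fun i j : Fin 2 => if i.val + j.val + 1 = 2 then (1 : L) else 0)).Local v × (cmDatum L 1 (Matrix.of fun i j : Fin 1 => if i.val + j.val + 1 = 1 then (1 : L) else 0)).Local v)} (hmH : mH.IsCanonical (IsLocalGRegular L v) νH)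
    (f : ((cmDatum L 2 (Matrix.of fun i j : Fin 2 => if i.val + j.val + 1 = 2 then (1 : L) else 0)).Local v × (cmDatum L 1 (Matrix.of fun i j : Fin 1 => if i.val + j.val + 1 = 1 then (1 : L) else 0)).Local v) → ℂ) (hf : IsLocSmooth f)
    (hfI : ∀ (g g' : ((cmDatum L 2 (Matrix.of fun i j : Fin 2 => if i.val + j.val + 1 = 2 then (1 : L) else 0)).Local v × (cmDatum L 1 (Matrix.of fun i j : Fin 1 => if i.val + j.val + 1 = 1 then (1 : L) else 0)).Local v)) (Q : GL (Fin 2) (LocalRing L v)) (d d' : Fin 2 → LocalRing L v),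
      (g.1.val.val : Matrix (Fin 2) (Fin 2) (LocalRing L v)) * Q.val = Q.val * diagonal d →
      (g'.1.val.val : Matrix (Fin 2) (Fin 2) (LocalRing L v)) * Q.val = Q.val * diagonal d' →
      (∀ i, conjLocal L (IsCMField.complexConj L) v (d i) * d i = 1) → (∀ i, conjLocal L (IsCMField.complexConj L) v (d' i) * d' i = 1) →
      Valued.v (d 0 w - d 1 w) = Valued.v (d' 0 w - d' 1 w) → f g = f g')
    {γH γH' : ((cmDatum L 2 (Matrix.of fun i j : Fin 2 => if i.val + j.val + 1 = 2 then (1 : L) else 0)).Local v × (cmDatum L 1 (Matrix.of fun i j : Fin 1 => if i.val + j.val + 1 = 1 then (1 : L) else 0)).Local v)} (hreg : IsLocalGRegular L v γH) (hreg' : IsLocalGRegular L v γH')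
    {P P' : GL (Fin 2) (LocalRing L v)} {u u' : Fin 2 → LocalRing L v}
    (hP : (γH.1.val.val : Matrix (Fin 2) (Fin 2) (LocalRing L v)) * P.val = P.val * diagonal u)
    (hu1 : ∀ i, conjLocal L (IsCMField.complexConj L) v (u i) * u i = 1)
    (hP' : (γH'.1.val.val : Matrix (Fin 2) (Fin 2) (LocalRing L v)) * P'.val = P'.val * diagonal u') (hu' : Function.Injective u')
    (hu'1 : ∀ i, conjLocal L (IsCMField.complexConj L) v (u' i) * u' i = 1)
    (hN : Valued.v (u 0 w - u 1 w) = Valued.v (u' 0 w - u' 1 w)) :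
    stableOrbitalIntegralRel (IsLocalStablyConjH L v) mH f γH = stableOrbitalIntegralRel (IsLocalStablyConjH L v) mH f γH' := by
  classical
  have hc1 : IsCMField.complexConj L ≠ 1 := IsCMField.complexConj_ne_one L
  haveI : Algebra.IsQuadraticExtension ↥(maximalRealSubfield L) L := IsCMField.isQuadraticExtension L
  haveI hv : Subsingleton (PlacesOver L v) := PlacesOver.subsingleton_of_smul_eq (IsCMField.complexConj L) hc1 w hw
  have hΦd : ((Matrix.of fun i j : Fin 2 => if i.val + j.val + 1 = 2 then (1 : L) else 0)).det ≠ 0 := (isUnit_antidiagOne_det (L := L) (N := 2)).ne_zero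
  -- the adapter's structural inputs for `Reg = IsLocalGRegular`
  have hReg : ∀ γ : ((cmDatum L 2 (Matrix.of fun i j : Fin 2 => if i.val + j.val + 1 = 2 then (1 : L) else 0)).Local v × (cmDatum L 1 (Matrix.of fun i j : Fin 1 => if i.val + j.val + 1 = 1 then (1 : L) else 0)).Local v), IsLocalGRegular L v γ → IsRegularElt (γ.1.val : GL (Fin 2) (LocalRing L v)) :=
    fun γ hγ => (isRegularElt_fst_snd_of_isLocalGRegular L v γ hγ).1
  have hconj : ∀ γ x : ((cmDatum L 2 (Matrix.of fun i j : Fin 2 => if i.val + j.val + 1 = 2 then (1 : L) else 0)).Local v × (cmDatum L 1 (Matrix.of fun i j : Fin 1 => if i.val + j.val + 1 = 1 then (1 : L) else 0)).Local v), IsLocalGRegular L v γ → IsLocalGRegular L v (x * γ * x⁻¹) := fun γ x hγ => (isLocalGRegular_conj_iff L x γ).2 hγ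
  have hstab : ∀ γ δ : ((cmDatum L 2 (Matrix.of fun i j : Fin 2 => if i.val + j.val + 1 = 2 then (1 : L) else 0)).Local v × (cmDatum L 1 (Matrix.of fun i j : Fin 1 => if i.val + j.val + 1 = 1 then (1 : L) else 0)).Local v), IsLocalGRegular L v γ → IsLocalStablyConjH L v γ δ → IsLocalGRegular L v δ :=
    fun γ δ hγ hst => isLocalGRegular_of_isLocalStablyConjH L v hst hγ
  -- the norm-one eigen-data `u` as units, and the diagonal `D = diag(u)`
  let dU : Fin 2 → (LocalRing L v)ˣ := fun i => ⟨u i, conjLocal L (IsCMField.complexConj L) v (u i), by rw [mul_comm]; exact hu1 i, hu1 i⟩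
  have hD : (glDiagonal 2 (LocalRing L v) dU).val = diagonal u := coe_glDiagonal 2 (LocalRing L v) dU
  have hPD : γH.1.val * P = P * glDiagonal 2 (LocalRing L v) dU := Units.ext (by rw [Units.val_mul, Units.val_mul, hD]; exact hP)
  -- §a RE-EIGENVALUE `γ_H′`: `ε₂ = P′ diag(u) P′⁻¹ ∈ U(Φ₂)_v` (the Gram matrix of the frame `P′` is diagonal), `ε := (ε₂, γ_H.2)`
  have hmem : P' * glDiagonal 2 (LocalRing L v) dU * P'⁻¹ ∈ «local» L (IsCMField.complexConj L) 2 (Matrix.of fun i j : Fin 2 => if i.val + j.val + 1 = 2 then (1 : L) else 0) v := by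
    letI : Field (LocalRing L v) := (LocalRing.isField_of_smul_eq (IsCMField.complexConj L) hc1 w hw).toField
    exact conj_glDiagonal_mem_unitaryGroupOfForm_of_eigenframe (conjLocal L (IsCMField.complexConj L) v) ((adelicForm L 2 (Matrix.of fun i j : Fin 2 => if i.val + j.val + 1 = 2 then (1 : L) else 0)).map (adeleToLocal L v))
      γH'.1.2 hP' hu' hu'1 dU (fun i => hu1 i)
  obtain ⟨ε₂, hε₂⟩ : ∃ ε₂ : ((cmDatum L 2 (Matrix.of fun i j : Fin 2 => if i.val + j.val + 1 = 2 then (1 : L) else 0)).Local v), ε₂.val = P' * glDiagonal 2 (LocalRing L v) dU * P'⁻¹ := ⟨⟨_, hmem⟩, rfl⟩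
  have hε₂mat : (ε₂.val.val : Matrix (Fin 2) (Fin 2) (LocalRing L v)) = P'.val * diagonal u * (P'⁻¹).val := by
    rw [hε₂, Units.val_mul, Units.val_mul, hD]
  have hεP : (ε₂.val.val : Matrix (Fin 2) (Fin 2) (LocalRing L v)) * P'.val = P'.val * diagonal u := by
    rw [hε₂mat, Matrix.mul_assoc, Units.inv_mul, Matrix.mul_one]
  -- `γ_H ∼st ε` (conjugator `P′ P⁻¹`, equal `U(Φ₁)`-parts), so `Φ^st(γ_H) = Φ^st(ε)` and `ε` is `G`-regular
  have hst : IsLocalStablyConjH L v γH (ε₂, γH.2) := by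
    refine ⟨isStablyConj_iff.2 ⟨P' * P⁻¹, ?_⟩, IsStablyConj.refl _⟩
    show P' * P⁻¹ * γH.1.val * (P' * P⁻¹)⁻¹ = ε₂.val
    rw [hε₂, _root_.mul_inv_rev, inv_inv, show P' * P⁻¹ * γH.1.val * (P * P'⁻¹) = P' * (P⁻¹ * (γH.1.val * P)) * P'⁻¹ by
      simp only [mul_assoc], hPD, inv_mul_cancel_left]
  have h1 : stableOrbitalIntegralRel (IsLocalStablyConjH L v) mH f γH = stableOrbitalIntegralRel (IsLocalStablyConjH L v) mH f (ε₂, γH.2) :=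
    stableOrbitalIntegralRel_congr (st := IsLocalStablyConjH L v) (γ := γH) (δ := (ε₂, γH.2))
      (fun δ => ⟨fun h => IsStablyConjH.trans (IsStablyConjH.symm hst) h, fun h => IsStablyConjH.trans hst h⟩) mH f
  have hregε : IsLocalGRegular L v (ε₂, γH.2) := hstab _ _ hreg hst
  have hregε₁ : IsRegularElt (ε₂.val : GL (Fin 2) (LocalRing L v)) := hReg (ε₂, γH.2) hregε
  have hreg'₁ : IsRegularElt (γH'.1.val : GL (Fin 2) (LocalRing L v)) := hReg γH' hreg'
  -- §b the PARTNER of `γ_H′` (★): `δ′`, stably conjugate (conjugator `x`) and not conjugate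
  obtain ⟨δ', hst', hnc', -⟩ := exists_isLocalStablyConjH_not_isConj_forall_isConj_or L w hw hP' hu' hu'1
  obtain ⟨x, hx⟩ := isStablyConj_iff.1 hst'.1
  have h2' : γH'.2 = δ'.2 := hst'.snd_eq
  -- §c TRANSPORT `ε₂` along `x`: `ε₂ ∈ Z(γ′₂)` (same frame), `δε₂ := x ε₂ x⁻¹ ∈ Z(δ′₂) ≤ U(Φ₂)_v` (★ `localStableCentralizerEquiv`)
  have hγ'mat : (γH'.1.val.val : Matrix (Fin 2) (Fin 2) (LocalRing L v)) = P'.val * diagonal u' * (P'⁻¹).val := by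
    rw [← hP', Matrix.mul_assoc, Units.mul_inv, Matrix.mul_one]
  have hCm : Commute (γH'.1.val.val : Matrix (Fin 2) (Fin 2) (LocalRing L v)) ε₂.val.val := by
    show γH'.1.val.val * ε₂.val.val = ε₂.val.val * γH'.1.val.val
    rw [hγ'mat, hε₂mat]; exact conj_diagonal_mul_comm P' u' u
  have hcomm : ε₂ * γH'.1 = γH'.1 * ε₂ := Subtype.ext (Units.ext hCm.eq.symm)
  have hZ2 : ε₂ ∈ Subgroup.centralizer ({γH'.1} : Set ((cmDatum L 2 (Matrix.of fun i j : Fin 2 => if i.val + j.val + 1 = 2 then (1 : L) else 0)).Local v)) := Subgroup.mem_centralizer_singleton_iff.2 hcomm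
  obtain ⟨δε₂, hδε₂⟩ : ∃ δε₂ : ((cmDatum L 2 (Matrix.of fun i j : Fin 2 => if i.val + j.val + 1 = 2 then (1 : L) else 0)).Local v), δε₂.val = x * ε₂.val * x⁻¹ :=
    ⟨((localStableCentralizerEquiv L v (N := 2) hΦd hΦd hst'.1 hreg'₁ ⟨ε₂, hZ2⟩ : ↥(Subgroup.centralizer ({δ'.1} : Set ((cmDatum L 2 (Matrix.of fun i j : Fin 2 => if i.val + j.val + 1 = 2 then (1 : L) else 0)).Local v)))) : ((cmDatum L 2 (Matrix.of fun i j : Fin 2 => if i.val + j.val + 1 = 2 then (1 : L) else 0)).Local v)),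
      coe_localStableCentralizerEquiv_eq_of_conj_eq L v hΦd hΦd hst'.1 hreg'₁ x hx ⟨ε₂, hZ2⟩⟩
  have hstε : IsLocalStablyConjH L v (ε₂, γH.2) (δε₂, γH.2) := ⟨isStablyConj_iff.2 ⟨x, hδε₂.symm⟩, IsStablyConj.refl _⟩
  -- `δε` is NOT conjugate to `ε`: a conjugator `c` would put `x⁻¹ c₂` in the (commutative ★) commutant of the regular `ε₂`, hence of `γ′₂`, making `δ′ ∼ γ_H′`
  have hncε : ¬ IsConj (ε₂, γH.2) (δε₂, γH.2) := by
    intro hcj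
    obtain ⟨c, hc⟩ := isConj_iff.1 hcj
    have hc₁ : c.1 * ε₂ * c.1⁻¹ = δε₂ := congrArg Prod.fst hc
    have hGL1 : c.1.val * ε₂.val * c.1.val⁻¹ = δε₂.val := congrArg Subtype.val hc₁
    have hB : x⁻¹ * c.1.val * ε₂.val = ε₂.val * (x⁻¹ * c.1.val) := by
      calc x⁻¹ * c.1.val * ε₂.val = x⁻¹ * (c.1.val * ε₂.val * c.1.val⁻¹) * c.1.val := by group
        _ = x⁻¹ * (x * ε₂.val * x⁻¹) * c.1.val := by rw [hGL1, hδε₂]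
        _ = ε₂.val * (x⁻¹ * c.1.val) := by group
    have hBm : Commute ((x⁻¹ * c.1.val).val : Matrix (Fin 2) (Fin 2) (LocalRing L v)) ε₂.val.val := by
      show (x⁻¹ * c.1.val).val * ε₂.val.val = ε₂.val.val * (x⁻¹ * c.1.val).val
      rw [← Units.val_mul, ← Units.val_mul, hB]
    have key := commute_of_commute_of_isRegularElt_local L v ε₂ hregε₁ _ _ hBm hCm
    have hGL2 : x⁻¹ * c.1.val * γH'.1.val = γH'.1.val * (x⁻¹ * c.1.val) :=
      Units.ext (by rw [Units.val_mul, Units.val_mul]; exact key.eq)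
    have hconj' : c.1 * γH'.1 * c.1⁻¹ = δ'.1 := by
      apply Subtype.ext
      show c.1.val * γH'.1.val * c.1.val⁻¹ = δ'.1.val
      rw [← hx]
      calc c.1.val * γH'.1.val * c.1.val⁻¹ = x * (x⁻¹ * c.1.val * γH'.1.val) * c.1.val⁻¹ := by group
        _ = x * (γH'.1.val * (x⁻¹ * c.1.val)) * c.1.val⁻¹ := by rw [hGL2]
        _ = x * γH'.1.val * x⁻¹ := by group
    refine hnc' (isConj_iff.2 ⟨(c.1, 1), Prod.ext hconj' ?_⟩)
    show (1 : ((cmDatum L 1 (Matrix.of fun i j : Fin 1 => if i.val + j.val + 1 = 1 then (1 : L) else 0)).Local v)) * γH'.2 * 1⁻¹ = δ'.2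
    rw [one_mul, inv_one, mul_one]; exact h2'
  have hregδε : IsLocalGRegular L v (δε₂, γH.2) := hstab _ _ hregε hstε
  -- §d frames: `ε, γ_H′` share `P′`; `δε, δ′` share `x P′`
  have hδ'P : (δ'.1.val.val : Matrix (Fin 2) (Fin 2) (LocalRing L v)) * (x * P').val = (x * P').val * diagonal u' := by
    rw [← hx]; exact conj_mul_frame_eq x γH'.1.val hP'
  have hδεP : (δε₂.val.val : Matrix (Fin 2) (Fin 2) (LocalRing L v)) * (x * P').val = (x * P').val * diagonal u := by
    rw [hδε₂]; exact conj_mul_frame_eq x ε₂.val hεP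
  -- §e the ADAPTER at `ε` (frame `P′`, data `u`, partner `δε`) and at `γ_H′` (frame `P′`, data `u′`, partner `δ′`)
  have hZε : (ε₂, γH.2) ∈ Subgroup.centralizer ({(ε₂, γH.2)} : Set ((cmDatum L 2 (Matrix.of fun i j : Fin 2 => if i.val + j.val + 1 = 2 then (1 : L) else 0)).Local v × (cmDatum L 1 (Matrix.of fun i j : Fin 1 => if i.val + j.val + 1 = 1 then (1 : L) else 0)).Local v)) := Subgroup.mem_centralizer_singleton_iff.2 rfl
  have hZ' : γH' ∈ Subgroup.centralizer ({γH'} : Set ((cmDatum L 2 (Matrix.of fun i j : Fin 2 => if i.val + j.val + 1 = 2 then (1 : L) else 0)).Local v × (cmDatum L 1 (Matrix.of fun i j : Fin 1 => if i.val + j.val + 1 = 1 then (1 : L) else 0)).Local v)) := Subgroup.mem_centralizer_singleton_iff.2 rfl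
  have hA : stableOrbitalIntegralRel (IsLocalStablyConjH L v) mH f (ε₂, γH.2) = (∫ y, f (y * (ε₂, γH.2) * y⁻¹) ∂νH) + ∫ y, f (y * (δε₂, γH.2) * y⁻¹) ∂νH :=
    stableOrbitalIntegralRel_eq_integral_add_integral_of_frame L v hv νH mH (IsLocalGRegular L v) hReg hconj hstab hmH f hf (ε₂, γH.2) P' u hregε₁ hεP hu1
      ⟨(ε₂, γH.2), hZε⟩ hregε (δε₂, γH.2) hstε hncε
  have hB : stableOrbitalIntegralRel (IsLocalStablyConjH L v) mH f γH' = (∫ y, f (y * γH' * y⁻¹) ∂νH) + ∫ y, f (y * δ' * y⁻¹) ∂νH :=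
    stableOrbitalIntegralRel_eq_integral_add_integral_of_frame L v hv νH mH (IsLocalGRegular L v) hReg hconj hstab hmH f hf γH' P' u' hreg'₁ hP' hu'1
      ⟨γH', hZ'⟩ hreg' δ' hst' hnc'
  -- §f the Bochner integrands agree pointwise (frames `y P′` and `y x P′`, same depth)
  have hI1 : ∀ y : ((cmDatum L 2 (Matrix.of fun i j : Fin 2 => if i.val + j.val + 1 = 2 then (1 : L) else 0)).Local v × (cmDatum L 1 (Matrix.of fun i j : Fin 1 => if i.val + j.val + 1 = 1 then (1 : L) else 0)).Local v), f (y * (ε₂, γH.2) * y⁻¹) = f (y * γH' * y⁻¹) := fun y =>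
    hfI (y * (ε₂, γH.2) * y⁻¹) (y * γH' * y⁻¹) (y.1.val * P') u u' (conj_mul_frame_eq y.1.val ε₂.val hεP) (conj_mul_frame_eq y.1.val γH'.1.val hP') hu1 hu'1 hN
  have hI2 : ∀ y : ((cmDatum L 2 (Matrix.of fun i j : Fin 2 => if i.val + j.val + 1 = 2 then (1 : L) else 0)).Local v × (cmDatum L 1 (Matrix.of fun i j : Fin 1 => if i.val + j.val + 1 = 1 then (1 : L) else 0)).Local v), f (y * (δε₂, γH.2) * y⁻¹) = f (y * δ' * y⁻¹) := fun y =>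
    hfI (y * (δε₂, γH.2) * y⁻¹) (y * δ' * y⁻¹) (y.1.val * (x * P')) u u' (conj_mul_frame_eq y.1.val δε₂.val hδεP) (conj_mul_frame_eq y.1.val δ'.1.val hδ'P) hu1 hu'1 hN
  rw [h1, hA, hB, show (fun y : ((cmDatum L 2 (Matrix.of fun i j : Fin 2 => if i.val + j.val + 1 = 2 then (1 : L) else 0)).Local v × (cmDatum L 1 (Matrix.of fun i j : Fin 1 => if i.val + j.val + 1 = 1 then (1 : L) else 0)).Local v) => f (y * (ε₂, γH.2) * y⁻¹)) = fun y => f (y * γH' * y⁻¹) from funext hI1,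
    show (fun y : ((cmDatum L 2 (Matrix.of fun i j : Fin 2 => if i.val + j.val + 1 = 2 then (1 : L) else 0)).Local v × (cmDatum L 1 (Matrix.of fun i j : Fin 1 => if i.val + j.val + 1 = 1 then (1 : L) else 0)).Local v) => f (y * (δε₂, γH.2) * y⁻¹)) = fun y => f (y * δ' * y⁻¹) from funext hI2]

end Place

/-! ## §2  The stub, TOKEN FOR TOKEN -/

-- `L_w`-sized statement: elaboration budget only (no search)
set_option maxHeartbeats 800000 in
/-- **`U2H_HSide.stub_U2H_stableOI_hProfiles_typeOne_wild` PAID BY NAME — THE H-SIDE PROFILES DEPEND ON THE DEPTH ONLY, AT ANY RAMIFIED NON-SPLIT PLACE.**  At a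
non-split RAMIFIED CM place `w ∣ v` (the dyadic binder `_h2` is carried but not used), for the canonical `mH`, there are `Y : Fin 2 → ℕ → ℂ` and `V ∈ 𝓝 1` (here `V = univ`)
such that for every `G`-regular ELLIPTIC type-(1) `γ_H ∈ V` with split eigen-data `α ≠ γ` at `w` of depth `N = ord_w(α − γ)`:
`Φ^st(γ_H, hFamily s) = ν_H(K_H) · Y s N` for `s = 0` (`1_{K_H}`) and `s = 1` (`1_{K♯ × U₁}`).  `Y s N := Φ^st(γ₀, hFamily s) ∕ ν_H(K_H)` at a chosen qualifying `γ₀` of depth `N`;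
independence of the choice is §1 `stableOrbitalIntegralRel_eq_of_frames_of_depth_eq` with ★ helper №1 `F0P3cDyRamHProfilesFrameDepth` (the profiles read (frame, depth) only) and ★ `isLocSmooth_hFamily`; frames from
the root `α` (★ `exists_eigenframe_cmDatum_local_of_isRoot_map_of_separable`), norm-one data from ellipticity (★ `forall_conjLocal_mul_eq_one_of_not_exists_conj_glDiagonal`).
Statement = the stub's, binders included. [cite: Rogawski1990, §4.9 Lemma 4.9.3 p. 56; §4.1 (4.1.1) p. 39; §3.6 p. 31] [cite: LabesseLanglands1979, §2] -/
theorem stableOrbitalIntegralRel_hFamily_eq_mul_of_depth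
    (L : Type) [Field L] [NumberField L] [IsCMField L]
    {v : HeightOneSpectrum (𝓞 ↥(maximalRealSubfield L))} (w : PlacesOver L v)
    (hw : IsCMField.complexConj L • w.1 = w.1) (he : v.asIdeal.ramificationIdx' w.1.asIdeal ≠ 1)
    (_h2 : ¬ IsUnit (2 : 𝒪[(w.1.adicCompletion L)]))
    (ϖ : (w.1.adicCompletion L)) (hϖ : Valued.v ϖ = WithZero.exp (-1 : ℤ))
    [MeasurableSpace ((cmDatum L 2 (Matrix.of fun i j : Fin 2 => if i.val + j.val + 1 = 2 then (1 : L) else 0)).Local v × (cmDatum L 1 (Matrix.of fun i j : Fin 1 => if i.val + j.val + 1 = 1 then (1 : L) else 0)).Local v)] [BorelSpace ((cmDatum L 2 (Matrix.of fun i j : Fin 2 => if i.val + j.val + 1 = 2 then (1 : L) else 0)).Local v × (cmDatum L 1 (Matrix.of fun i j : Fin 1 => if i.val + j.val + 1 = 1 then (1 : L) else 0)).Local v)]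
    [∀ a : ((cmDatum L 2 (Matrix.of fun i j : Fin 2 => if i.val + j.val + 1 = 2 then (1 : L) else 0)).Local v × (cmDatum L 1 (Matrix.of fun i j : Fin 1 => if i.val + j.val + 1 = 1 then (1 : L) else 0)).Local v), MeasurableSpace (((cmDatum L 2 (Matrix.of fun i j : Fin 2 => if i.val + j.val + 1 = 2 then (1 : L) else 0)).Local v × (cmDatum L 1 (Matrix.of fun i j : Fin 1 => if i.val + j.val + 1 = 1 then (1 : L) else 0)).Local v) ⧸ Subgroup.centralizer ({a} : Set ((cmDatum L 2 (Matrix.of fun i j : Fin 2 => if i.val + j.val + 1 = 2 then (1 : L) else 0)).Local v × (cmDatum L 1 (Matrix.of fun i j : Fin 1 => if i.val + j.val + 1 = 1 then (1 : L) else 0)).Local v)))]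
    [∀ a : ((cmDatum L 2 (Matrix.of fun i j : Fin 2 => if i.val + j.val + 1 = 2 then (1 : L) else 0)).Local v × (cmDatum L 1 (Matrix.of fun i j : Fin 1 => if i.val + j.val + 1 = 1 then (1 : L) else 0)).Local v), BorelSpace (((cmDatum L 2 (Matrix.of fun i j : Fin 2 => if i.val + j.val + 1 = 2 then (1 : L) else 0)).Local v × (cmDatum L 1 (Matrix.of fun i j : Fin 1 => if i.val + j.val + 1 = 1 then (1 : L) else 0)).Local v) ⧸ Subgroup.centralizer ({a} : Set ((cmDatum L 2 (Matrix.of fun i j : Fin 2 => if i.val + j.val + 1 = 2 then (1 : L) else 0)).Local v × (cmDatum L 1 (Matrix.of fun i j : Fin 1 => if i.val + j.val + 1 = 1 then (1 : L) else 0)).Local v)))]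
    (νH : Measure ((cmDatum L 2 (Matrix.of fun i j : Fin 2 => if i.val + j.val + 1 = 2 then (1 : L) else 0)).Local v × (cmDatum L 1 (Matrix.of fun i j : Fin 1 => if i.val + j.val + 1 = 1 then (1 : L) else 0)).Local v)) [νH.IsHaarMeasure] [νH.IsMulRightInvariant]
    {mH : OrbitalMeasureFamily ((cmDatum L 2 (Matrix.of fun i j : Fin 2 => if i.val + j.val + 1 = 2 then (1 : L) else 0)).Local v × (cmDatum L 1 (Matrix.of fun i j : Fin 1 => if i.val + j.val + 1 = 1 then (1 : L) else 0)).Local v)} (hmH : mH.IsCanonical (IsLocalGRegular L v) νH) :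
    ∃ Y : Fin 2 → ℕ → ℂ, ∃ V ∈ 𝓝 (1 : ((cmDatum L 2 (Matrix.of fun i j : Fin 2 => if i.val + j.val + 1 = 2 then (1 : L) else 0)).Local v × (cmDatum L 1 (Matrix.of fun i j : Fin 1 => if i.val + j.val + 1 = 1 then (1 : L) else 0)).Local v)),
      ∀ γH ∈ V, IsLocalGRegular L v γH →
        (∃ x : (w.1.adicCompletion L), (((γH.1.val : GL (Fin 2) (UnitaryGroup.LocalRing L v)).val.map
          (Pi.evalRingHom (fun w' : PlacesOver L v => w'.1.adicCompletion L) w)).charpoly).IsRoot x) →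
        ¬ (∃ (y : ((cmDatum L 2 (Matrix.of fun i j : Fin 2 => if i.val + j.val + 1 = 2 then (1 : L) else 0)).Local v × (cmDatum L 1 (Matrix.of fun i j : Fin 1 => if i.val + j.val + 1 = 1 then (1 : L) else 0)).Local v)) (d' : Fin 2 → (UnitaryGroup.LocalRing L v)ˣ),
          glDiagonal 2 (UnitaryGroup.LocalRing L v) d' = ((y * γH * y⁻¹).1.val : GL (Fin 2) (UnitaryGroup.LocalRing L v))) →
        ∀ (α γ : (w.1.adicCompletion L)),
          ((((γH.1.val : GL (Fin 2) (UnitaryGroup.LocalRing L v)) : Matrix (Fin 2) (Fin 2) (UnitaryGroup.LocalRing L v)).charpoly).map (Pi.evalRingHom (fun w' : PlacesOver L v => w'.1.adicCompletion L) w)).IsRoot α →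
          ((((γH.1.val : GL (Fin 2) (UnitaryGroup.LocalRing L v)) : Matrix (Fin 2) (Fin 2) (UnitaryGroup.LocalRing L v)).charpoly).map (Pi.evalRingHom (fun w' : PlacesOver L v => w'.1.adicCompletion L) w)).IsRoot γ →
          α ≠ γ → ∀ N : ℕ, Valued.v (α - γ) = WithZero.exp (-(N : ℤ)) →
          stableOrbitalIntegralRel (IsLocalStablyConjH L v) mH
            (hFamily L w hw ϖ 0) γH = ((νH.real (((cmLocalIntegralLevel L 2 (Matrix.of fun i j : Fin 2 => if i.val + j.val + 1 = 2 then (1 : L) else 0) v).prod (cmLocalIntegralLevel L 1 (Matrix.of fun i j : Fin 1 => if i.val + j.val + 1 = 1 then (1 : L) else 0) v) : Subgroup _) : Set _) : ℝ) : ℂ) * Y 0 N ∧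
          stableOrbitalIntegralRel (IsLocalStablyConjH L v) mH
            (hFamily L w hw ϖ 1) γH = ((νH.real (((cmLocalIntegralLevel L 2 (Matrix.of fun i j : Fin 2 => if i.val + j.val + 1 = 2 then (1 : L) else 0) v).prod (cmLocalIntegralLevel L 1 (Matrix.of fun i j : Fin 1 => if i.val + j.val + 1 = 1 then (1 : L) else 0) v) : Subgroup _) : Set _) : ℝ) : ℂ) * Y 1 N := by
  classical
  have hc1 : IsCMField.complexConj L ≠ 1 := IsCMField.complexConj_ne_one L
  haveI : Algebra.IsQuadraticExtension ↥(maximalRealSubfield L) L := IsCMField.isQuadraticExtension L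
  have hϖ0 : ϖ ≠ 0 := by
    intro h0
    rw [h0, map_zero] at hϖ
    exact WithZero.coe_ne_zero hϖ.symm
  -- smoothness of the two profiles (★ LH4-p05) and their (frame, depth)-reading (★ helper №1)
  have hsm : ∀ s, IsLocSmooth (hFamily L w hw ϖ s) := fun s => F0P3cDyRamHFamilySmooth.isLocSmooth_hFamily L w hw he ϖ hϖ s
  have hI0 : ∀ (g g' : ((cmDatum L 2 (Matrix.of fun i j : Fin 2 => if i.val + j.val + 1 = 2 then (1 : L) else 0)).Local v × (cmDatum L 1 (Matrix.of fun i j : Fin 1 => if i.val + j.val + 1 = 1 then (1 : L) else 0)).Local v)) (Q : GL (Fin 2) (LocalRing L v)) (d d' : Fin 2 → LocalRing L v),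
      (g.1.val.val : Matrix (Fin 2) (Fin 2) (LocalRing L v)) * Q.val = Q.val * diagonal d →
      (g'.1.val.val : Matrix (Fin 2) (Fin 2) (LocalRing L v)) * Q.val = Q.val * diagonal d' →
      (∀ i, conjLocal L (IsCMField.complexConj L) v (d i) * d i = 1) → (∀ i, conjLocal L (IsCMField.complexConj L) v (d' i) * d' i = 1) →
      Valued.v (d 0 w - d 1 w) = Valued.v (d' 0 w - d' 1 w) → hFamily L w hw ϖ 0 g = hFamily L w hw ϖ 0 g' :=
    fun g g' Q d d' hQ hQ' hd hd' hNN => by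
      show hProfileZero L v g = hProfileZero L v g'
      exact hProfileZero_eq_of_frame L w hw g g' Q d d' hQ hQ' hd hd' hNN
  have hI1 : ∀ (g g' : ((cmDatum L 2 (Matrix.of fun i j : Fin 2 => if i.val + j.val + 1 = 2 then (1 : L) else 0)).Local v × (cmDatum L 1 (Matrix.of fun i j : Fin 1 => if i.val + j.val + 1 = 1 then (1 : L) else 0)).Local v)) (Q : GL (Fin 2) (LocalRing L v)) (d d' : Fin 2 → LocalRing L v),
      (g.1.val.val : Matrix (Fin 2) (Fin 2) (LocalRing L v)) * Q.val = Q.val * diagonal d →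
      (g'.1.val.val : Matrix (Fin 2) (Fin 2) (LocalRing L v)) * Q.val = Q.val * diagonal d' →
      (∀ i, conjLocal L (IsCMField.complexConj L) v (d i) * d i = 1) → (∀ i, conjLocal L (IsCMField.complexConj L) v (d' i) * d' i = 1) →
      Valued.v (d 0 w - d 1 w) = Valued.v (d' 0 w - d' 1 w) → hFamily L w hw ϖ 1 g = hFamily L w hw ϖ 1 g' :=
    fun g g' Q d d' hQ hQ' hd hd' hNN => by
      show hProfileSharp L w hw ϖ g = hProfileSharp L w hw ϖ g'
      exact hProfileSharp_eq_of_frame L w hw hϖ0 g g' Q d d' hQ hQ' hd hd' hNN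
  -- positivity of `ν_H(K_H)`
  have hKpos : ((νH.real (((cmLocalIntegralLevel L 2 (Matrix.of fun i j : Fin 2 => if i.val + j.val + 1 = 2 then (1 : L) else 0) v).prod (cmLocalIntegralLevel L 1 (Matrix.of fun i j : Fin 1 => if i.val + j.val + 1 = 1 then (1 : L) else 0) v) : Subgroup _) : Set ((cmDatum L 2 (Matrix.of fun i j : Fin 2 => if i.val + j.val + 1 = 2 then (1 : L) else 0)).Local v × (cmDatum L 1 (Matrix.of fun i j : Fin 1 => if i.val + j.val + 1 = 1 then (1 : L) else 0)).Local v)) : ℝ) : ℂ) ≠ 0 := by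
    have hK2 := isCompact_isOpen_cmLocalIntegralLevel L 2 (Matrix.of fun i j : Fin 2 => if i.val + j.val + 1 = 2 then (1 : L) else 0) v
    have hK1' := isCompact_isOpen_cmLocalIntegralLevel L 1 (Matrix.of fun i j : Fin 1 => if i.val + j.val + 1 = 1 then (1 : L) else 0) v
    have h : νH.real (((cmLocalIntegralLevel L 2 (Matrix.of fun i j : Fin 2 => if i.val + j.val + 1 = 2 then (1 : L) else 0) v).prod (cmLocalIntegralLevel L 1 (Matrix.of fun i j : Fin 1 => if i.val + j.val + 1 = 1 then (1 : L) else 0) v) : Subgroup _) : Set ((cmDatum L 2 (Matrix.of fun i j : Fin 2 => if i.val + j.val + 1 = 2 then (1 : L) else 0)).Local v × (cmDatum L 1 (Matrix.of fun i j : Fin 1 => if i.val + j.val + 1 = 1 then (1 : L) else 0)).Local v)) ≠ 0 := by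
      rw [measureReal_def]
      exact (ENNReal.toReal_pos ((hK2.2.prod hK1'.2).measure_pos νH ⟨(1, 1), Subgroup.one_mem _, Subgroup.one_mem _⟩).ne'
        (hK2.1.prod hK1'.1).measure_lt_top.ne).ne'
    exact_mod_cast h
  -- eigenframes of qualifying elements: frame through `α`, second eigenvalue `γ`, norm-one data, depth `N`
  have hframe : ∀ (γH : ((cmDatum L 2 (Matrix.of fun i j : Fin 2 => if i.val + j.val + 1 = 2 then (1 : L) else 0)).Local v × (cmDatum L 1 (Matrix.of fun i j : Fin 1 => if i.val + j.val + 1 = 1 then (1 : L) else 0)).Local v)) (α γ : w.1.adicCompletion L) (N : ℕ), IsLocalGRegular L v γH →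
      ¬ (∃ (y : ((cmDatum L 2 (Matrix.of fun i j : Fin 2 => if i.val + j.val + 1 = 2 then (1 : L) else 0)).Local v × (cmDatum L 1 (Matrix.of fun i j : Fin 1 => if i.val + j.val + 1 = 1 then (1 : L) else 0)).Local v)) (d' : Fin 2 → (UnitaryGroup.LocalRing L v)ˣ), glDiagonal 2 (UnitaryGroup.LocalRing L v) d' = ((y * γH * y⁻¹).1.val : GL (Fin 2) (UnitaryGroup.LocalRing L v))) →
      ((((γH.1.val : GL (Fin 2) (UnitaryGroup.LocalRing L v)) : Matrix (Fin 2) (Fin 2) (UnitaryGroup.LocalRing L v)).charpoly).map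
        (Pi.evalRingHom (fun w' : PlacesOver L v => w'.1.adicCompletion L) w)).IsRoot α →
      ((((γH.1.val : GL (Fin 2) (UnitaryGroup.LocalRing L v)) : Matrix (Fin 2) (Fin 2) (UnitaryGroup.LocalRing L v)).charpoly).map
        (Pi.evalRingHom (fun w' : PlacesOver L v => w'.1.adicCompletion L) w)).IsRoot γ →
      α ≠ γ → Valued.v (α - γ) = WithZero.exp (-(N : ℤ)) →
      ∃ (P : GL (Fin 2) (LocalRing L v)) (u : Fin 2 → LocalRing L v),
        (γH.1.val.val : Matrix (Fin 2) (Fin 2) (LocalRing L v)) * P.val = P.val * diagonal u ∧ Function.Injective u ∧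
        (∀ i, conjLocal L (IsCMField.complexConj L) v (u i) * u i = 1) ∧ Valued.v (u 0 w - u 1 w) = WithZero.exp (-(N : ℤ)) := by
    intro γH α γ N hreg hell hα hγ hαγ hN
    have hsep : (((γH.1.val : GL (Fin 2) (LocalRing L v)) : Matrix (Fin 2) (Fin 2) (LocalRing L v)).charpoly).Separable :=
      (isRegularElt_fst_snd_of_isLocalGRegular L v γH hreg).1
    obtain ⟨P, u, hP, hu, hu0⟩ := exists_eigenframe_cmDatum_local_of_isRoot_map_of_separable L v w hw γH.1 hα hsep
    have hu1w : u 1 w = γ := by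
      rcases eq_or_eq_eval_of_isRoot_of_eigenframe L v w hP hγ with h | h
      · exact absurd (h.trans hu0) (Ne.symm hαγ)
      · exact h.symm
    exact ⟨P, u, hP, hu, forall_conjLocal_mul_eq_one_of_not_exists_conj_glDiagonal L v w hw hP hu hell, by rw [hu0, hu1w]; exact hN⟩
  -- the profiles: the common value at a chosen qualifying element of depth `N`
  refine ⟨fun s N =>
      if hq : ∃ γ₀ : ((cmDatum L 2 (Matrix.of fun i j : Fin 2 => if i.val + j.val + 1 = 2 then (1 : L) else 0)).Local v × (cmDatum L 1 (Matrix.of fun i j : Fin 1 => if i.val + j.val + 1 = 1 then (1 : L) else 0)).Local v), ∃ α₀ γ₀' : w.1.adicCompletion L, IsLocalGRegular L v γ₀ ∧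
          ¬ (∃ (y : ((cmDatum L 2 (Matrix.of fun i j : Fin 2 => if i.val + j.val + 1 = 2 then (1 : L) else 0)).Local v × (cmDatum L 1 (Matrix.of fun i j : Fin 1 => if i.val + j.val + 1 = 1 then (1 : L) else 0)).Local v)) (d' : Fin 2 → (UnitaryGroup.LocalRing L v)ˣ), glDiagonal 2 (UnitaryGroup.LocalRing L v) d' = ((y * γ₀ * y⁻¹).1.val : GL (Fin 2) (UnitaryGroup.LocalRing L v))) ∧
          ((((γ₀.1.val : GL (Fin 2) (UnitaryGroup.LocalRing L v)) : Matrix (Fin 2) (Fin 2) (UnitaryGroup.LocalRing L v)).charpoly).map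
            (Pi.evalRingHom (fun w' : PlacesOver L v => w'.1.adicCompletion L) w)).IsRoot α₀ ∧
          ((((γ₀.1.val : GL (Fin 2) (UnitaryGroup.LocalRing L v)) : Matrix (Fin 2) (Fin 2) (UnitaryGroup.LocalRing L v)).charpoly).map
            (Pi.evalRingHom (fun w' : PlacesOver L v => w'.1.adicCompletion L) w)).IsRoot γ₀' ∧
          α₀ ≠ γ₀' ∧ Valued.v (α₀ - γ₀') = WithZero.exp (-(N : ℤ))
      then stableOrbitalIntegralRel (IsLocalStablyConjH L v) mH (hFamily L w hw ϖ s) hq.choose /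
        ((νH.real (((cmLocalIntegralLevel L 2 (Matrix.of fun i j : Fin 2 => if i.val + j.val + 1 = 2 then (1 : L) else 0) v).prod (cmLocalIntegralLevel L 1 (Matrix.of fun i j : Fin 1 => if i.val + j.val + 1 = 1 then (1 : L) else 0) v) : Subgroup _) : Set ((cmDatum L 2 (Matrix.of fun i j : Fin 2 => if i.val + j.val + 1 = 2 then (1 : L) else 0)).Local v × (cmDatum L 1 (Matrix.of fun i j : Fin 1 => if i.val + j.val + 1 = 1 then (1 : L) else 0)).Local v)) : ℝ) : ℂ)
      else 0,
    Set.univ, Filter.univ_mem, ?_⟩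
  intro γH _ hreg _ hell α γ hα hγ hαγ N hN
  have hq : ∃ γ₀ : ((cmDatum L 2 (Matrix.of fun i j : Fin 2 => if i.val + j.val + 1 = 2 then (1 : L) else 0)).Local v × (cmDatum L 1 (Matrix.of fun i j : Fin 1 => if i.val + j.val + 1 = 1 then (1 : L) else 0)).Local v), ∃ α₀ γ₀' : w.1.adicCompletion L, IsLocalGRegular L v γ₀ ∧
      ¬ (∃ (y : ((cmDatum L 2 (Matrix.of fun i j : Fin 2 => if i.val + j.val + 1 = 2 then (1 : L) else 0)).Local v × (cmDatum L 1 (Matrix.of fun i j : Fin 1 => if i.val + j.val + 1 = 1 then (1 : L) else 0)).Local v)) (d' : Fin 2 → (UnitaryGroup.LocalRing L v)ˣ), glDiagonal 2 (UnitaryGroup.LocalRing L v) d' = ((y * γ₀ * y⁻¹).1.val : GL (Fin 2) (UnitaryGroup.LocalRing L v))) ∧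
      ((((γ₀.1.val : GL (Fin 2) (UnitaryGroup.LocalRing L v)) : Matrix (Fin 2) (Fin 2) (UnitaryGroup.LocalRing L v)).charpoly).map
        (Pi.evalRingHom (fun w' : PlacesOver L v => w'.1.adicCompletion L) w)).IsRoot α₀ ∧
      ((((γ₀.1.val : GL (Fin 2) (UnitaryGroup.LocalRing L v)) : Matrix (Fin 2) (Fin 2) (UnitaryGroup.LocalRing L v)).charpoly).map
        (Pi.evalRingHom (fun w' : PlacesOver L v => w'.1.adicCompletion L) w)).IsRoot γ₀' ∧
      α₀ ≠ γ₀' ∧ Valued.v (α₀ - γ₀') = WithZero.exp (-(N : ℤ)) := ⟨γH, α, γ, hreg, hell, hα, hγ, hαγ, hN⟩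
  obtain ⟨hreg₀, hell₀, hα₀, hγ₀, hαγ₀, hN₀⟩ := hq.choose_spec.choose_spec.choose_spec
  obtain ⟨P, u, hP, -, hu1, hNu⟩ := hframe γH α γ N hreg hell hα hγ hαγ hN
  obtain ⟨P₀, u₀, hP₀, hu₀, hu₀1, hNu₀⟩ := hframe hq.choose _ _ N hreg₀ hell₀ hα₀ hγ₀ hαγ₀ hN₀
  have hNN : Valued.v (u 0 w - u 1 w) = Valued.v (u₀ 0 w - u₀ 1 w) := by rw [hNu, hNu₀]
  have key : ∀ s, stableOrbitalIntegralRel (IsLocalStablyConjH L v) mH (hFamily L w hw ϖ s) γH =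
      stableOrbitalIntegralRel (IsLocalStablyConjH L v) mH (hFamily L w hw ϖ s) hq.choose := by
    intro s
    fin_cases s
    · exact stableOrbitalIntegralRel_eq_of_frames_of_depth_eq L w hw νH hmH (hFamily L w hw ϖ 0) (hsm 0) hI0 hreg hreg₀ hP hu1 hP₀ hu₀ hu₀1 hNN
    · exact stableOrbitalIntegralRel_eq_of_frames_of_depth_eq L w hw νH hmH (hFamily L w hw ϖ 1) (hsm 1) hI1 hreg hreg₀ hP hu1 hP₀ hu₀ hu₀1 hNN
  dsimp only
  rw [dif_pos hq, dif_pos hq, mul_div_cancel₀ _ hKpos, mul_div_cancel₀ _ hKpos]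
  exact ⟨key 0, key 1⟩
end Summit.HodgeConjecture.HodgeConjecture.Cruxes.H413.F0P3cDyRamU2HStableOIHProfilesTypeOneWild

end
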